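import Summits.Ventures.CertifiedManyBodySolver.Downfold.EmeryScaleRayCellL
import Summits.Ventures.CertifiedManyBodySolver.Downfold.EmeryScaleEdgeChain
import Summits.Ventures.CertifiedManyBodySolver.Downfold.EmeryOxygenHoppingLipschitz
import HarnessLib

/-!
# THE TELESCOPED EDGE CELL WITH LIPSCHITZ RAY TRANSPORT: one `Δ′`-cell of the ceiling edge `(Δ′, a₂, b₂)` (UPPER) or floor edge `(Δ′, a₁, b₁)` (LOWER)
# with its value bound, its `t_pp` stage and its oxygen-hopping RAY stage on a per-cell step range `s ∈ [sLo, sHi]` — `T((Δ′, a₂, b, c) + s·(0,0,b,c)) ≤ (1 + s)·U`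
# and `(1 − s)·L ≤ T((Δ′, a₁, b, c) − s·(0,0,b,c))`; the member's Fermi energy is transported CERTIFICATE-FREE (INFL-3to1-B §B.91 (c′))

Venture CertifiedManyBodySolver, cell `pub/hubbard-downfold` (stage S1; INFLATION-RULES-3to1-B §B.91), seat hubbard-downfold-mod-4 (technique B = band
level, g40); namespace `Summit.Ventures.CertifiedManyBodySolver.Downfold.Emery`. Everything PROVED (0 sorry). WHAT THIS IS NOT: a statement about any
material; no number lives here; `U = 0` one-body kinematics of the σ model.

OBJECT. `T(θ) = t_node(θ; ε_F(θ; ν))` for rows `θ = (Δ, t_pd, t_pp, t_pp′)` with ONE `t_pp′` value `c` (thin-`c` boxes; `c` is both the `cN` and the `cP`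
of the §B.88 `T̃`). An EDGE CELL carries: a `Δ′`-interval `iD`, an energy WINDOW `W` valid for EVERY edge point of the cell (supplied from two telescoped
point brackets and the `Δ`-antitonicity of `ε_F` — `EmeryFermiEnergyExistsAll.fermiEnergyOf_mem_Icc_of_mem_box'` — by `EmeryScaleEdgeBox`), a VALUE check of
`t((Δ′, a, b_edge, c); W.lo)` (UPPER; `W.hi` LOWER) against the scaled integer bound, a `t_pp` STAGE (`EmeryScaleBoxChain.stageCheck`, anchored on the
edge family with window `W`), and per `t_pp`-cell a RAY STAGE (`EmeryScaleRayCellL.rayCellCheckL` cells covering `s ∈ [sLo/SC, sHi/SC]`). This is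
the certificate-free-transport variant of `EmeryScaleEdgeChain` (same data structures `RCell` / `BNodeR` / `ECell`, same `coversBy`): along the member
`(Δ′, a, b + s·b, c + s·c)` the Fermi energy obeys `ε_F(A) − 4cs ≤ ε_F(M) ≤ ε_F(A) + 4bs` (`EmeryOxygenHoppingLipschitz.fermiEnergyOf_tpp_shift_mem_Icc`,
`…_tppP_shift_mem_Icc`), and along `(Δ′, a, b − s·b, c − s·c)` one has `ε_F(M) ≤ ε_F(A) + 4cs`; the cells' thin rates are checked against `4·IC`, `4·famB`.

* §1 the per-cell tests `rayCellOKL`, `rayStageCheckL` (step range `[sLo, sHi]`), `edgeCellOKL`.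
* §2 **`ray_stageL_upper`** / **`ray_stageL_lower`** (soundness of a ray stage on an anchor family, Lipschitz transport inside).
* §3 **`edge_cellL_upper`**: for every `Δ′` of the cell (window hypothesis), every `b ∈ [b₂ − wB/SC, b₂]`, every `s` with `sLo ≤ s·SC ≤ sHi`:
  `T(Δ′, a₂, b + s·b, c + s·c) ≤ (1 + s)·U/SC`; **`edge_cellL_lower`**: `(1 − s)·L/SC ≤ T(Δ′, a₁, b − s·b, c − s·c)` for `b ∈ [b₁, b₁ + wB/SC]`.
The box theorems (scaling law, per-cell step ranges, covering of the extended edges) are in `EmeryScaleEdgeBoxL`.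

Sources: three-band model [HybertsenSchluterChristensen1989, Eq. (1)]; energy-linearised one-band image [AndersenEtAl1995, §6]; interval arithmetic
[folklore] (Moore 1966).
-/

noncomputable section

namespace Summit.Ventures.CertifiedManyBodySolver.Downfold.Emery

open Real Set Literature.Analysis.ValidatedNumerics.Numerics

/-! ## §1 Tests -/

/-- Per-ray-cell test: the kernel ray cell check (`rayCellCheckL`) on the family box `(famD, IA, famB)` with window `W`, plus bookkeeping — direction
`(0, 0, ±famB, ±IC)`, base `t_pp′ = IC`, thin rates, and the LIPSCHITZ RATE CONDITIONS: UPPER `σp ≤ −4·IC.hi` (i.e. `ℓ ≥ 4c`), `σe ≥ 4·famB.hi` (`u ≥ 4b`);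
LOWER `σe = σp ≥ 4·IC.hi` (`u ≥ 4c`). [folklore] -/
def rayCellOKL (upper : Bool) (IC famD IA famB W : FI) (rc : RCell) : Bool :=
  rayCellCheckL upper rc.cd rc.n ⟨famD, IA, famB, rc.iS, W⟩ &&
  decide (rc.cd.dD = thin 0) && decide (rc.cd.dA = thin 0) && decide (rc.cd.IC = IC) &&
  decide (rc.cd.sgE.lo = rc.cd.sgE.hi) && decide (rc.cd.sgP.lo = rc.cd.sgP.hi) &&
  (if upper then decide (rc.cd.dB = famB) && decide (rc.cd.dC = IC) && decide (rc.cd.sgP.hi ≤ -((IC.mulInt 4).hi)) && decide ((famB.mulInt 4).hi ≤ rc.cd.sgE.lo)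
    else decide (rc.cd.dB = famB.neg) && decide (rc.cd.dC = IC.neg) && decide (rc.cd.sgE = rc.cd.sgP) && decide ((IC.mulInt 4).hi ≤ rc.cd.sgP.lo))

/-- A ray stage: the cells cover `[sLo, sHi]` and each passes `rayCellOKL`. [folklore] -/
def rayStageCheckL (upper : Bool) (IC famD IA famB W : FI) (sLo sHi : ℤ) (rays : List RCell) : Bool :=
  coversBy RCell.iS sLo sHi rays && rays.all (rayCellOKL upper IC famD IA famB W)

/-- Per-edge-cell test (UPPER: edge `(Δ′, a₂, b₂)`, `t_pp` direction `−1`, value at `W.lo`; LOWER: edge `(Δ′, a₁, b₁)`, direction `+1`, value at `W.hi`):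
value check, regime scalars of the edge step, `t_pp` stage, ray stages on `[sLo, sHi]`. [folklore] -/
def edgeCellOKL (upper : Bool) (IC IA IB : FI) (wB sLo sHi V whlo : ℤ) (ec : ECell) : Bool :=
  let eV : FI := if upper then thin ec.W.lo else thin ec.W.hi
  let dirB : FI := if upper then thin (-(SC : ℤ)) else thin (SC : ℤ)
  valueCheck upper IC V ec.nv ⟨ec.iD, IA, IB, thin 0, eV⟩ &&
  decide (0 < ec.W.lo) && decide (0 < ec.iD.lo) && decide (0 < IA.lo) && decide (0 ≤ IC.lo) && decide (0 ≤ (IB.sub IC).lo) &&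
  decide ((IC.mul (thin ec.W.hi)).hi < (IA.sqr).lo) && decide ((IB.mul ec.iD).hi < ((IA.sqr).mulInt 4).lo) &&
  stageCheck upper (thin 0) (thin 0) dirB IC IC whlo ec.iD IA IB ec.W wB (ec.bnodes.map (·.cell)) &&
  ec.bnodes.all (fun nb => rayStageCheckL upper IC ec.iD IA (famOf IB nb.cell.iS dirB) nb.cell.Wout sLo sHi nb.rays)

/-! ## §2 Ray stages -/

section RayStage

variable {IC famD IA famB W : FI} {sLo sHi : ℤ} {rays : List RCell} {c ν : ℝ}

/-- `x·SC·4 ≤ (I.mulInt 4).hi` for `x ∈ I`: the Lipschitz rate floors read off the data. [folklore] -/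
theorem four_mul_le_of_mem {x : ℝ} {I : FI} {k : ℤ} (hx : FI.mem x I) (h : (I.mulInt 4).hi ≤ k) : 4 * x ≤ (k : ℝ) / SC := by
  have hm := FI.mem_mulInt hx 4
  have h' : ((I.mulInt 4).hi : ℝ) ≤ (k : ℝ) := by exact_mod_cast h
  rw [le_div_iff₀ SC_pos]
  have := hm.2.trans h'
  push_cast at this
  linarith

/-- **RAY STAGE SOUNDNESS, UPPER**: for every anchor `A = (Δ, a, b, c)` of the family, every `s` with `sLo ≤ s·SC ≤ sHi`, `s ≥ 0`, given `ε_F(A) ∈ W`: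
`T(Δ, a, b + s·b, c + s·c) ≤ (1 + s)·T(A)` — the member's Fermi energy is transported by `EmeryOxygenHoppingLipschitz`. [folklore] -/
theorem ray_stageL_upper (h : rayStageCheckL true IC famD IA famB W sLo sHi rays = true) (hC : FI.mem c IC) (hν0 : 0 < ν) (hν1 : ν < 1)
    {Δ a b s : ℝ} (hD : FI.mem Δ famD) (hA : FI.mem a IA) (hB : FI.mem b famB) (hs0 : 0 ≤ s) (hsLo : (sLo : ℝ) ≤ s * SC)
    (hsHi : s * SC ≤ (sHi : ℝ)) (hW : FI.mem (fermiEnergyOf Δ a b c ν) W) :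
    scaleNodeN Δ a (b + s * b) (c + s * c) (fermiEnergyOf Δ a (b + s * b) (c + s * c) ν) /
        scaleNodeD Δ a (b + s * b) (c + s * c) (fermiEnergyOf Δ a (b + s * b) (c + s * c) ν) ≤
      (1 + s) * (scaleNodeN Δ a b c (fermiEnergyOf Δ a b c ν) / scaleNodeD Δ a b c (fermiEnergyOf Δ a b c ν)) := by
  obtain ⟨-, -, h0⟩ := mem_dirs
  simp only [rayStageCheckL, Bool.and_eq_true] at h
  obtain ⟨hcov, hall⟩ := h
  obtain ⟨rc, hrc, hsc⟩ := exists_of_coversBy RCell.iS rays sLo sHi hcov s hsLo hsHi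
  have hok := List.all_eq_true.1 hall rc hrc
  unfold rayCellOKL at hok
  simp only [Bool.and_eq_true, decide_eq_true_eq, ↓reduceIte] at hok
  obtain ⟨⟨⟨⟨⟨⟨hcell, e1⟩, e2⟩, e3⟩, tE⟩, tP⟩, ⟨⟨⟨e4, e5⟩, hP4⟩, hE4⟩⟩ := hok
  set ℓ : ℝ := -((rc.cd.sgP.lo : ℝ) / SC) with hℓ
  set u : ℝ := (rc.cd.sgE.lo : ℝ) / SC with hu
  have mP : FI.mem (-ℓ) rc.cd.sgP := by rw [hℓ, neg_neg]; exact mem_val_of_thin tP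
  have mE : FI.mem u rc.cd.sgE := mem_val_of_thin tE
  have mH : FI.mem ((rc.cd.sgH.lo : ℝ) / SC) (thin rc.cd.sgH.lo) := mem_thin _
  have hcd : FI.mem (0 : ℝ) rc.cd.dD ∧ FI.mem (0 : ℝ) rc.cd.dA ∧ FI.mem b rc.cd.dB ∧ FI.mem c rc.cd.dC ∧ FI.mem c rc.cd.IC ∧ FI.mem u rc.cd.sgE ∧
      FI.mem ((rc.cd.sgH.lo : ℝ) / SC) (thin rc.cd.sgH.lo) ∧ FI.mem (-ℓ) rc.cd.sgP := by
    refine ⟨?_, ?_, ?_, ?_, ?_, mE, mH, mP⟩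
    · rw [e1]; exact h0
    · rw [e2]; exact h0
    · rw [e4]; exact hB
    · rw [e5]; exact hC
    · rw [e3]; exact hC
  -- scalars for the Lipschitz lemmas
  obtain ⟨-, HD, HA, HB, HC, -, -, HBM, -, -, Hs, -⟩ := rayCellCheckL_scalars (cd := ⟨rc.cd.dD, rc.cd.dA, rc.cd.dB, rc.cd.dC, rc.cd.IC, rc.cd.sgE,
    thin rc.cd.sgH.lo, rc.cd.sgP⟩) hcd hcell hD hA hB hsc
  -- rates: ℓ ≥ 4c, u ≥ 4b
  have hℓ4 : 4 * c ≤ ℓ := by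
    have h4 := four_mul_le_of_mem hC (le_refl ((IC.mulInt 4).hi))
    have : ((rc.cd.sgP.hi : ℝ)) ≤ -(((IC.mulInt 4).hi : ℝ)) := by exact_mod_cast hP4
    have tPr : (rc.cd.sgP.lo : ℝ) = rc.cd.sgP.hi := by exact_mod_cast tP
    rw [hℓ, tPr]
    have : (((IC.mulInt 4).hi : ℤ) : ℝ) / SC ≤ -((rc.cd.sgP.hi : ℝ) / SC) := by
      rw [← neg_div]; exact div_le_div_of_nonneg_right (by linarith) SC_pos.le
    linarith
  have hu4 : 4 * b ≤ u := four_mul_le_of_mem hB hE4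
  -- Lipschitz transport
  have h1 := fermiEnergyOf_tpp_shift_mem_Icc (β := s * b) (ν := ν) HD HA.ne' HC HB (mul_nonneg hs0 HB) hν0 hν1
  have h2 := fermiEnergyOf_tppP_shift_mem_Icc (γ := s * c) (ν := ν) (b := b + s * b) HD HA.ne' HC HBM (mul_nonneg hs0 HC) hν0 hν1
  have hlo : fermiEnergyOf Δ a b c ν - ℓ * s ≤ fermiEnergyOf (Δ + s * 0) (a + s * 0) (b + s * b) (c + s * c) ν := by
    simp only [mul_zero, add_zero]
    have := h2.1; have := h1.1; nlinarith
  have hhi : fermiEnergyOf (Δ + s * 0) (a + s * 0) (b + s * b) (c + s * c) ν ≤ fermiEnergyOf Δ a b c ν + u * s := by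
    simp only [mul_zero, add_zero]
    have := h2.2; have := h1.2; nlinarith
  have hT := rayL_upper_cell (cd := ⟨rc.cd.dD, rc.cd.dA, rc.cd.dB, rc.cd.dC, rc.cd.IC, rc.cd.sgE, thin rc.cd.sgH.lo, rc.cd.sgP⟩) hcd hcell hD hA hB hsc
    hW hlo hhi
  simp only [mul_zero, add_zero] at hT
  exact hT

/-- **RAY STAGE SOUNDNESS, LOWER**: for every anchor `A = (Δ, a, b, c)` of the family, every `s` with `sLo ≤ s·SC ≤ sHi`, `s ≥ 0`, given `ε_F(A) ∈ W`:
`(1 − s)·T(A) ≤ T(Δ, a, b − s·b, c − s·c)`. [folklore] -/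
theorem ray_stageL_lower (h : rayStageCheckL false IC famD IA famB W sLo sHi rays = true) (hC : FI.mem c IC) (hν0 : 0 < ν) (hν1 : ν < 1)
    {Δ a b s : ℝ} (hD : FI.mem Δ famD) (hA : FI.mem a IA) (hB : FI.mem b famB) (hs0 : 0 ≤ s) (hsLo : (sLo : ℝ) ≤ s * SC)
    (hsHi : s * SC ≤ (sHi : ℝ)) (hW : FI.mem (fermiEnergyOf Δ a b c ν) W) :
    (1 - s) * (scaleNodeN Δ a b c (fermiEnergyOf Δ a b c ν) / scaleNodeD Δ a b c (fermiEnergyOf Δ a b c ν)) ≤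
      scaleNodeN Δ a (b - s * b) (c - s * c) (fermiEnergyOf Δ a (b - s * b) (c - s * c) ν) /
        scaleNodeD Δ a (b - s * b) (c - s * c) (fermiEnergyOf Δ a (b - s * b) (c - s * c) ν) := by
  obtain ⟨-, -, h0⟩ := mem_dirs
  simp only [rayStageCheckL, Bool.and_eq_true] at h
  obtain ⟨hcov, hall⟩ := h
  obtain ⟨rc, hrc, hsc⟩ := exists_of_coversBy RCell.iS rays sLo sHi hcov s hsLo hsHi
  have hok := List.all_eq_true.1 hall rc hrc
  unfold rayCellOKL at hok
  simp only [Bool.and_eq_true, decide_eq_true_eq, Bool.false_eq_true, ↓reduceIte] at hok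
  obtain ⟨⟨⟨⟨⟨⟨hcell, e1⟩, e2⟩, e3⟩, tE⟩, tP⟩, ⟨⟨⟨e4, e5⟩, hsgn⟩, hP4⟩⟩ := hok
  set u : ℝ := (rc.cd.sgP.lo : ℝ) / SC with hu
  have mP : FI.mem u rc.cd.sgP := mem_val_of_thin tP
  have mE : FI.mem u rc.cd.sgE := by rw [hsgn]; exact mP
  have mH : FI.mem ((rc.cd.sgH.lo : ℝ) / SC) (thin rc.cd.sgH.lo) := mem_thin _
  have hcd : FI.mem (0 : ℝ) rc.cd.dD ∧ FI.mem (0 : ℝ) rc.cd.dA ∧ FI.mem (-b) rc.cd.dB ∧ FI.mem (-c) rc.cd.dC ∧ FI.mem c rc.cd.IC ∧ FI.mem u rc.cd.sgE ∧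
      FI.mem ((rc.cd.sgH.lo : ℝ) / SC) (thin rc.cd.sgH.lo) ∧ FI.mem u rc.cd.sgP := by
    refine ⟨?_, ?_, ?_, ?_, ?_, mE, mH, mP⟩
    · rw [e1]; exact h0
    · rw [e2]; exact h0
    · rw [e4]; exact FI.mem_neg hB
    · rw [e5]; exact FI.mem_neg hC
    · rw [e3]; exact hC
  obtain ⟨-, HD, HA, HB, HC, -, -, HBM, HCM, -, Hs, -⟩ := rayCellCheckL_scalars (cd := ⟨rc.cd.dD, rc.cd.dA, rc.cd.dB, rc.cd.dC, rc.cd.IC, rc.cd.sgE,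
    thin rc.cd.sgH.lo, rc.cd.sgP⟩) hcd hcell hD hA hB hsc
  simp only [mul_neg] at HBM HCM
  have hu4 : 4 * c ≤ u := four_mul_le_of_mem hC hP4
  -- Lipschitz transport: E(b − sb, c − sc) ≤ E(b − sb, c) + 4sc ≤ E(b, c) + 4sc
  have eB : b + -(s * b) + s * b = b := by ring
  have eC : c + -(s * c) + s * c = c := by ring
  have h1 := fermiEnergyOf_tppP_shift_mem_Icc (γ := s * c) (ν := ν) (b := b + -(s * b)) (c := c + -(s * c)) HD HA.ne' HCM HBM (mul_nonneg hs0 HC) hν0 hν1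
  have h2 := fermiEnergyOf_tpp_shift_mem_Icc (β := s * b) (ν := ν) (b := b + -(s * b)) (c := c) HD HA.ne' HC HBM (mul_nonneg hs0 HB) hν0 hν1
  rw [eC] at h1
  rw [eB] at h2
  have hhi : fermiEnergyOf (Δ + s * 0) (a + s * 0) (b + s * -b) (c + s * -c) ν ≤ fermiEnergyOf Δ a b c ν + u * s := by
    simp only [mul_zero, add_zero, mul_neg]
    have := h1.1; have := h2.1; nlinarith
  have hT := (rayL_lower_cell (cd := ⟨rc.cd.dD, rc.cd.dA, rc.cd.dB, rc.cd.dC, rc.cd.IC, rc.cd.sgE, thin rc.cd.sgH.lo, rc.cd.sgP⟩) hcd hν0 hν1 hcell hD hA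
    hB hsc hW hhi)
  simp only [mul_zero, add_zero, mul_neg] at hT
  have e6 : b + -(s * b) = b - s * b := by ring
  have e7 : c + -(s * c) = c - s * c := by ring
  rw [e6, e7] at hT
  exact hT

end RayStage

/-! ## §3 Edge cells -/

section EdgeCell

variable {IC IA IB : FI} {wB sLo sHi V whlo : ℤ} {ec : ECell} {c a₀ b₀ ν : ℝ}

/-- **EDGE CELL SOUNDNESS, UPPER.** Edge `(Δ′, a₀, b₀)` = `(Δ′, a₂, b₂)`: for every `Δ′` of the cell with `ε_F(Δ′, a₀, b₀, c) ∈ W`, every `b` with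
`b ≤ b₀`, `(b₀ − b)·SC ≤ wB`, every `s ≥ 0` with `sLo ≤ s·SC ≤ sHi`, given the `t_pp`-member floor:
**`T(Δ′, a₀, b + s·b, c + s·c) ≤ (1 + s)·V/SC`**. [folklore] -/
theorem edge_cellL_upper (h : edgeCellOKL true IC IA IB wB sLo sHi V whlo ec = true) (hC : FI.mem c IC) (hA : FI.mem a₀ IA) (hB : FI.mem b₀ IB)
    (hν0 : 0 < ν) (hν1 : ν < 1) {Δ' b s : ℝ} (hD : FI.mem Δ' ec.iD) (hW : FI.mem (fermiEnergyOf Δ' a₀ b₀ c ν) ec.W) (hb1 : b ≤ b₀)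
    (hb2 : (b₀ - b) * SC ≤ (wB : ℝ)) (hs0 : 0 ≤ s) (hsLo : (sLo : ℝ) ≤ s * SC) (hsHi : s * SC ≤ (sHi : ℝ))
    (hcrude : (whlo : ℝ) / SC ≤ fermiEnergyOf Δ' a₀ b c ν) :
    scaleNodeN Δ' a₀ (b + s * b) (c + s * c) (fermiEnergyOf Δ' a₀ (b + s * b) (c + s * c) ν) /
        scaleNodeD Δ' a₀ (b + s * b) (c + s * c) (fermiEnergyOf Δ' a₀ (b + s * b) (c + s * c) ν) ≤ (1 + s) * ((V : ℝ) / SC) := by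
  obtain ⟨h1, hm1, h0⟩ := mem_dirs
  unfold edgeCellOKL at h
  simp only [↓reduceIte, Bool.and_eq_true, decide_eq_true_eq] at h
  obtain ⟨⟨⟨⟨⟨⟨⟨⟨⟨hval, hWlo⟩, hD0⟩, hA0⟩, hC0⟩, hBC⟩, hregm⟩, hregq⟩, hstage⟩, hrays⟩ := h
  -- reals
  have HΔ : 0 < Δ' := FI.pos_of_lo_pos hD hD0
  have HA : 0 < a₀ := FI.pos_of_lo_pos hA hA0
  have HC : 0 ≤ c := nonneg_of_lo_nonneg hC hC0
  have HBC : c ≤ b₀ := by have := nonneg_of_lo_nonneg (FI.mem_sub hB hC) hBC; linarith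
  set E := fermiEnergyOf Δ' a₀ b₀ c ν with hE
  have hWI := mem_Icc_of_fimem hW
  have HWlo : 0 < (ec.W.lo : ℝ) / SC := div_pos (by exact_mod_cast hWlo) SC_pos
  -- (1) the edge value: T̃(Δ′, a₀, b₀) ≤ t(·; W.lo) ≤ V/SC
  have hm : c * E < a₀ ^ 2 := by
    have := FI.lt_of_hi_lt_lo (FI.mem_mul hC (mem_thin ec.W.hi)) (FI.mem_sqr hA) hregm
    exact lt_of_le_of_lt (mul_le_mul_of_nonneg_left hWI.2 HC) this
  have hq : b₀ * Δ' < 4 * a₀ ^ 2 := by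
    have := FI.lt_of_hi_lt_lo (FI.mem_mul hB hD) (FI.mem_mulInt (FI.mem_sqr hA) 4) hregq
    push_cast at this; linarith
  have hedge : scaleNodeN Δ' a₀ b₀ c E / scaleNodeD Δ' a₀ b₀ c E ≤ (V : ℝ) / SC := by
    have hanti := scaleNode_div_antitone HΔ HC HBC HA.ne' HWlo hWI.1 hm hq
    have hv := scaleNode_div_le_of_valueCheck hval hC (s := 0) (e := (ec.W.lo : ℝ) / SC) hD hA hB (by simpa using h0) (mem_thin ec.W.lo)
    exact hanti.trans hv
  -- (2) the t_pp stage: b = b₀ + sB·(−1)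
  set sB := b₀ - b with hsB
  have hsB0 : 0 ≤ sB := by rw [hsB]; linarith
  have eB : b₀ + -sB = b := by rw [hsB]; ring
  have stB := stage_upper hstage h0 h0 hm1 hC hC hν0 hν1 hD hA hB hsB0 hb2 hW (by
    simp only [mul_zero, add_zero, mul_neg, mul_one, eB]; exact hcrude)
  simp only [mul_zero, add_zero, mul_neg, mul_one, eB] at stB
  obtain ⟨hTB, cb, hcb, hscb, hWB⟩ := stB
  obtain ⟨nb, hnb, rfl⟩ := List.mem_map.1 hcb
  have hray := List.all_eq_true.1 hrays nb hnb
  -- (3) the ray stage on the member family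
  have mb : FI.mem b (famOf IB nb.cell.iS (thin (-(SC : ℤ)))) := by
    have := mem_famOf hB hscb hm1; simp only [mul_neg, mul_one, eB] at this; exact this
  have hR := ray_stageL_upper hray hC hν0 hν1 hD hA mb hs0 hsLo hsHi hWB
  have h1s : 0 ≤ 1 + s := by linarith
  calc _ ≤ (1 + s) * (scaleNodeN Δ' a₀ b c (fermiEnergyOf Δ' a₀ b c ν) / scaleNodeD Δ' a₀ b c (fermiEnergyOf Δ' a₀ b c ν)) := hR
    _ ≤ (1 + s) * (scaleNodeN Δ' a₀ b₀ c E / scaleNodeD Δ' a₀ b₀ c E) := mul_le_mul_of_nonneg_left hTB h1s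
    _ ≤ (1 + s) * ((V : ℝ) / SC) := mul_le_mul_of_nonneg_left hedge h1s

/-- **EDGE CELL SOUNDNESS, LOWER.** Edge `(Δ′, a₀, b₀)` = `(Δ′, a₁, b₁)`: for every `Δ′` of the cell with `ε_F(Δ′, a₀, b₀, c) ∈ W`, every `b` with
`b₀ ≤ b`, `(b − b₀)·SC ≤ wB`, every `s ≥ 0` with `sLo ≤ s·SC ≤ sHi` and `s ≤ 1`: **`(1 − s)·V/SC ≤ T(Δ′, a₀, b − s·b, c − s·c)`**. [folklore] -/
theorem edge_cellL_lower (h : edgeCellOKL false IC IA IB wB sLo sHi V whlo ec = true) (hC : FI.mem c IC) (hA : FI.mem a₀ IA) (hB : FI.mem b₀ IB)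
    (hν0 : 0 < ν) (hν1 : ν < 1) {Δ' b s : ℝ} (hD : FI.mem Δ' ec.iD) (hW : FI.mem (fermiEnergyOf Δ' a₀ b₀ c ν) ec.W) (hb1 : b₀ ≤ b)
    (hb2 : (b - b₀) * SC ≤ (wB : ℝ)) (hs0 : 0 ≤ s) (hsLo : (sLo : ℝ) ≤ s * SC) (hsHi : s * SC ≤ (sHi : ℝ)) (hs1 : s ≤ 1) :
    (1 - s) * ((V : ℝ) / SC) ≤ scaleNodeN Δ' a₀ (b - s * b) (c - s * c) (fermiEnergyOf Δ' a₀ (b - s * b) (c - s * c) ν) /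
        scaleNodeD Δ' a₀ (b - s * b) (c - s * c) (fermiEnergyOf Δ' a₀ (b - s * b) (c - s * c) ν) := by
  obtain ⟨h1, hm1, h0⟩ := mem_dirs
  unfold edgeCellOKL at h
  simp only [Bool.false_eq_true, ↓reduceIte, Bool.and_eq_true, decide_eq_true_eq] at h
  obtain ⟨⟨⟨⟨⟨⟨⟨⟨⟨hval, hWlo⟩, hD0⟩, hA0⟩, hC0⟩, hBC⟩, hregm⟩, hregq⟩, hstage⟩, hrays⟩ := h
  have HΔ : 0 < Δ' := FI.pos_of_lo_pos hD hD0
  have HA : 0 < a₀ := FI.pos_of_lo_pos hA hA0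
  have HC : 0 ≤ c := nonneg_of_lo_nonneg hC hC0
  have HBC : c ≤ b₀ := by have := nonneg_of_lo_nonneg (FI.mem_sub hB hC) hBC; linarith
  have HB : 0 ≤ b₀ := HC.trans HBC
  set E := fermiEnergyOf Δ' a₀ b₀ c ν with hE
  have hWI := mem_Icc_of_fimem hW
  have HE0 : 0 < E := fermiEnergyOf_pos HΔ HA.ne' HC HB hν0 hν1
  -- (1) the edge value: V/SC ≤ t(·; W.hi) ≤ T̃(Δ′, a₀, b₀)
  have hm : c * ((ec.W.hi : ℝ) / SC) < a₀ ^ 2 := FI.lt_of_hi_lt_lo (FI.mem_mul hC (mem_thin ec.W.hi)) (FI.mem_sqr hA) hregm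
  have hq : b₀ * Δ' < 4 * a₀ ^ 2 := by
    have := FI.lt_of_hi_lt_lo (FI.mem_mul hB hD) (FI.mem_mulInt (FI.mem_sqr hA) 4) hregq
    push_cast at this; linarith
  have hedge : (V : ℝ) / SC ≤ scaleNodeN Δ' a₀ b₀ c E / scaleNodeD Δ' a₀ b₀ c E := by
    have hanti := scaleNode_div_antitone HΔ HC HBC HA.ne' HE0 hWI.2 hm hq
    have hv := le_scaleNode_div_of_valueCheck hval hC (s := 0) (e := (ec.W.hi : ℝ) / SC) hD hA hB (by simpa using h0) (mem_thin ec.W.hi)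
    exact hv.trans hanti
  -- (2) the t_pp stage: b = b₀ + sB·(+1)
  set sB := b - b₀ with hsB
  have hsB0 : 0 ≤ sB := by rw [hsB]; linarith
  have eB : b₀ + sB = b := by rw [hsB]; ring
  have hmono : fermiEnergyOf Δ' a₀ b₀ c ν ≤ fermiEnergyOf (Δ' + sB * 0) (a₀ + sB * 0) (b₀ + sB * 1) c ν := by
    simp only [mul_zero, add_zero, mul_one, eB]
    exact (fermiEnergyOf_mem_Icc_of_mem_box' (Δ := Δ') (a := a₀) (b := b) (c := c) HΔ HA HB HC ⟨le_rfl, le_rfl⟩ ⟨le_rfl, le_rfl⟩ ⟨hb1, le_rfl⟩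
      ⟨le_rfl, le_rfl⟩ hν0 hν1).1
  have stB := stage_lower hstage h0 h0 h1 hC hC hν0 hν1 hD hA hB hsB0 hb2 hW hmono
  simp only [mul_zero, add_zero, mul_one, eB] at stB
  obtain ⟨hTB, cb, hcb, hscb, hWB⟩ := stB
  obtain ⟨nb, hnb, rfl⟩ := List.mem_map.1 hcb
  have hray := List.all_eq_true.1 hrays nb hnb
  -- (3) the ray stage on the member family
  have mb : FI.mem b (famOf IB nb.cell.iS (thin (SC : ℤ))) := by
    have := mem_famOf hB hscb h1; simp only [mul_one, eB] at this; exact this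
  have hR := ray_stageL_lower hray hC hν0 hν1 hD hA mb hs0 hsLo hsHi hWB
  have h1s : 0 ≤ 1 - s := by linarith
  calc (1 - s) * ((V : ℝ) / SC) ≤ (1 - s) * (scaleNodeN Δ' a₀ b₀ c E / scaleNodeD Δ' a₀ b₀ c E) := mul_le_mul_of_nonneg_left hedge h1s
    _ ≤ (1 - s) * (scaleNodeN Δ' a₀ b c (fermiEnergyOf Δ' a₀ b c ν) / scaleNodeD Δ' a₀ b c (fermiEnergyOf Δ' a₀ b c ν)) :=
        mul_le_mul_of_nonneg_left hTB h1s
    _ ≤ _ := hR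

end EdgeCell

end Summit.Ventures.CertifiedManyBodySolver.Downfold.Emery
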